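import Summits.QuantumFields.YangMills.Theorems.DiagonalMirrorRPRCubeSurgeryDefs
import Summits.QuantumFields.YangMills.Theorems.DiagonalMirrorRPROddTorusSwapPairingDefs
import Summits.QuantumFields.YangMills.Theorems.DiagonalMirrorRPRTwistLettersDefs

/-!
# Crux `WeakCouplingHypercubicLimitRP` (stmt-QuantumFields-27395 / twin 27398) — crux-ideate g4 k1, idea
# `far-kernel-rank-one-mixture`: FIRST LEMMA sketch (elaborates; sorries only in the two `stub_*`).

Door E for the socket `OddTorusSwapPairingLiminf` (D1″): MARKOV CUT of the odd torus along the two collar walls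
`|v| ∈ {M, M+1}`, `v = x₀ − x₁`, + the observation that a MIXTURE of exactly swap-RP near-slab forms whose mixing kernel is a
REFLECTED PRODUCT `z(η₊) z(Θη₋)` is exactly swap-RP.  Hence the swap-RP defect of the odd torus on near-slab observables is at
most `‖F‖∞² ·` (weighted `L¹` distance of the FAR-CYLINDER two-wall kernel `K(η₊,η₋)` from the reflected rank-one cone)
— §A is the (trivial, proved) finite engine; §B types the decomposition on Wilson's own torus, the finite-volume mixture
inequality (stub E1, provable: FILS inside the slab with frozen asymmetric collars + §A), the LETTER `FarWallDecoupling`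
(E2: the far kernel's rank-one defect is super-polynomially small — two-wall interaction free energy → 0) and the bridge to
the socket (stub E3).  Nothing here is proved about Wilson's model at weak coupling; the crux, S6i and the summit are OPEN.
-/

set_option autoImplicit false

noncomputable section

open scoped SchwartzMap
open MeasureTheory Filter Topology
open Literature.MathematicalPhysics.QuantumLattice Literature.MathematicalPhysics.AQFT
  Literature.MathematicalPhysics.QuantumFieldTheory
open Literature.Probability.LatticeModels (box)
open Summit.QuantumFields.YangMills.Cruxes.DiagonalMirrorRPR.ParityBridgeColdTraces (E4)
open Summit.QuantumFields.YangMills.Cruxes.DiagonalMirrorRPR.SignTwistedDiagonalTrace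
  (ReflectedFamily gramPairing famObs OddTorusSwapPairingLiminf Growth)

namespace Summit.QuantumFields.YangMills.Cruxes.WeakCouplingHypercubicLimitRP.FarKernelMixture

/-! ## §A The finite engine (PROVED): a mixture of RP forms against a kernel `K` is bounded below by minus the
`Φ₁`-weighted `L¹` distance of `K` from a reflected product `z ⊗ z`. -/

section Engine

variable {Y : Type*} [Fintype Y]

/-- Mixture lower bound: `Φ` = the near-slab form `(a,b) ↦ Z_in^{FΘ·F}(a,b)` (PSD in the collar pair, `|Φ| ≤ B² Φ₁`),
`K` = far kernel, `z` = any wall weight. -/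
theorem mixture_pairing_lower (Φ Φ₁ K : Y → Y → ℝ) (z : Y → ℝ) (B : ℝ)
    (hpsd : 0 ≤ ∑ a, ∑ b, z a * z b * Φ a b) (hdom : ∀ a b, |Φ a b| ≤ B ^ 2 * Φ₁ a b) :
    -(B ^ 2 * ∑ a, ∑ b, Φ₁ a b * |K a b - z a * z b|) ≤ ∑ a, ∑ b, Φ a b * K a b := by
  have hsplit : ∑ a, ∑ b, Φ a b * K a b =
      (∑ a, ∑ b, z a * z b * Φ a b) + ∑ a, ∑ b, Φ a b * (K a b - z a * z b) := by
    rw [← Finset.sum_add_distrib]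
    refine Finset.sum_congr rfl fun a _ => ?_
    rw [← Finset.sum_add_distrib]
    refine Finset.sum_congr rfl fun b _ => ?_
    ring
  have hrem : -(B ^ 2 * ∑ a, ∑ b, Φ₁ a b * |K a b - z a * z b|) ≤
      ∑ a, ∑ b, Φ a b * (K a b - z a * z b) := by
    rw [Finset.mul_sum, ← Finset.sum_neg_distrib]
    refine Finset.sum_le_sum fun a _ => ?_
    rw [Finset.mul_sum, ← Finset.sum_neg_distrib]
    refine Finset.sum_le_sum fun b _ => ?_
    have h1 : |Φ a b * (K a b - z a * z b)| ≤ B ^ 2 * (Φ₁ a b * |K a b - z a * z b|) := by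
      rw [abs_mul, ← mul_assoc]
      exact mul_le_mul_of_nonneg_right (hdom a b) (abs_nonneg _)
    have h2 := neg_abs_le (Φ a b * (K a b - z a * z b))
    linarith
  rw [hsplit]
  linarith

/-- Normalisation lower bound: `Z ≥ (rank-one mass) − (defect)`. -/
theorem mixture_norm_lower (Φ₁ K : Y → Y → ℝ) (z : Y → ℝ) (hΦ₁ : ∀ a b, 0 ≤ Φ₁ a b) :
    (∑ a, ∑ b, Φ₁ a b * (z a * z b)) - ∑ a, ∑ b, Φ₁ a b * |K a b - z a * z b| ≤
      ∑ a, ∑ b, Φ₁ a b * K a b := by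
  rw [← Finset.sum_sub_distrib]
  refine Finset.sum_le_sum fun a _ => ?_
  rw [← Finset.sum_sub_distrib]
  refine Finset.sum_le_sum fun b _ => ?_
  have h := neg_abs_le (K a b - z a * z b)
  have h2 : Φ₁ a b * (z a * z b) - Φ₁ a b * |K a b - z a * z b| =
      Φ₁ a b * (z a * z b - |K a b - z a * z b|) := by ring
  rw [h2]
  exact mul_le_mul_of_nonneg_left (by linarith) (hΦ₁ a b)

/-- The ratio form the bridge consumes: normalised swap pairing `≥ −B² · D/(1−D)` in un-normalised currency. -/
theorem mixture_ratio_lower (Φ Φ₁ K : Y → Y → ℝ) (z : Y → ℝ) (B : ℝ)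
    (hpsd : 0 ≤ ∑ a, ∑ b, z a * z b * Φ a b) (hdom : ∀ a b, |Φ a b| ≤ B ^ 2 * Φ₁ a b)
    (hΦ₁ : ∀ a b, 0 ≤ Φ₁ a b)
    (hD : ∑ a, ∑ b, Φ₁ a b * |K a b - z a * z b| < ∑ a, ∑ b, Φ₁ a b * (z a * z b)) :
    -(B ^ 2 * (∑ a, ∑ b, Φ₁ a b * |K a b - z a * z b|) /
        ((∑ a, ∑ b, Φ₁ a b * (z a * z b)) - ∑ a, ∑ b, Φ₁ a b * |K a b - z a * z b|)) ≤
      (∑ a, ∑ b, Φ a b * K a b) / ∑ a, ∑ b, Φ₁ a b * K a b := by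
  set Dn := ∑ a, ∑ b, Φ₁ a b * |K a b - z a * z b| with hDn_def
  set Dd := ∑ a, ∑ b, Φ₁ a b * (z a * z b) with hDd_def
  set P := ∑ a, ∑ b, Φ a b * K a b with hP_def
  set P₁ := ∑ a, ∑ b, Φ₁ a b * K a b with hP₁_def
  have h1 : -(B ^ 2 * Dn) ≤ P := mixture_pairing_lower Φ Φ₁ K z B hpsd hdom
  have h2 : Dd - Dn ≤ P₁ := mixture_norm_lower Φ₁ K z hΦ₁
  have hpos : 0 < Dd - Dn := by linarith
  have hP₁ : 0 < P₁ := lt_of_lt_of_le hpos h2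
  have hDn : 0 ≤ Dn :=
    Finset.sum_nonneg fun a _ => Finset.sum_nonneg fun b _ => mul_nonneg (hΦ₁ a b) (abs_nonneg _)
  by_cases hP : 0 ≤ P
  · have hq : 0 ≤ P / P₁ := div_nonneg hP hP₁.le
    have hq' : 0 ≤ B ^ 2 * Dn / (Dd - Dn) := div_nonneg (mul_nonneg (sq_nonneg B) hDn) hpos.le
    linarith
  · push Not at hP
    have hstep1 : -(B ^ 2 * Dn / (Dd - Dn)) ≤ P / (Dd - Dn) := by
      rw [← neg_div]
      exact div_le_div_of_nonneg_right h1 hpos.le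
    have hstep2 : P / (Dd - Dn) ≤ P / P₁ := by
      have hneg : (-P) / P₁ ≤ (-P) / (Dd - Dn) := div_le_div_of_nonneg_left (by linarith) hpos h2
      rw [neg_div, neg_div] at hneg
      linarith
    exact hstep1.trans hstep2

end Engine

/-! ## §B The Markov–mirror decomposition of Wilson's odd torus in the light-cone coordinate `v = x₀ − x₁` -/

section Model

variable {G : Type} [Group G]

/-- Centred light-cone coordinate `v = x₀ − x₁ ∈ (−S/2, S/2]` of a torus site. -/
def vc (S : ℕ) (x : Site 4 S) : ℤ := ((x 0 - x 1 : ZMod S)).valMinAbs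

/-- `v` of the tail and of the head of a positively oriented link. -/
def vTail (S : ℕ) (e : Edge 4 S) : ℤ := vc S e.1

/-- see `vTail` -/
def vHead (S : ℕ) (e : Edge 4 S) : ℤ := vc S (e.1.shift e.2)

/-- INNER links (integrated in the near slab): both endpoints in `|v| ≤ M`, one of them in `|v| ≤ M − 1`. -/
def InnerE (S M : ℕ) (e : Edge 4 S) : Prop :=
  |vTail S e| ≤ M ∧ |vHead S e| ≤ M ∧ (|vTail S e| + 1 ≤ M ∨ |vHead S e| + 1 ≤ M)

/-- COLLAR links (the two walls, frozen): both endpoints in `M ≤ |v| ≤ M + 1`. -/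
def CollarE (S M : ℕ) (e : Edge 4 S) : Prop :=
  (M : ℤ) ≤ |vTail S e| ∧ |vTail S e| ≤ M + 1 ∧ (M : ℤ) ≤ |vHead S e| ∧ |vHead S e| ≤ M + 1

/-- The positive wall. -/
def PosCollarE (S M : ℕ) (e : Edge 4 S) : Prop := CollarE S M e ∧ 0 ≤ vTail S e

/-- OUTER links (integrated in the far cylinder): some endpoint in `|v| ≥ M + 2`. -/
def OuterE (S M : ℕ) (e : Edge 4 S) : Prop := (M : ℤ) + 2 ≤ |vTail S e| ∨ (M : ℤ) + 2 ≤ |vHead S e|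

/-- Links of the closed positive near half-slab `0 ≤ v ≤ M` (where the observables live). -/
def PosNearE (S M : ℕ) (e : Edge 4 S) : Prop :=
  0 ≤ vTail S e ∧ vTail S e ≤ M ∧ 0 ≤ vHead S e ∧ vHead S e ≤ M

/-- The four corners of a plaquette `(x; i<j)`. -/
def corners (S : ℕ) (p : Plaquette 4 S) : Fin 4 → Site 4 S :=
  ![p.1, p.1.shift p.2.1.1, p.1.shift p.2.1.2, (p.1.shift p.2.1.1).shift p.2.1.2]

/-- INNER plaquettes: some corner in `|v| ≤ M − 1` (then every corner is in `|v| ≤ M + 1`: all its links are inner or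
collar — NO plaquette contains an inner and an outer link, the Markov property of the cut). -/
def InnerP (S M : ℕ) (p : Plaquette 4 S) : Prop := ∃ i : Fin 4, |vc S (corners S p i)| + 1 ≤ M

open Classical in
/-- Near-slab Wilson action: inner plaquettes only. -/
def innerAction {N : ℕ} (ρ : G →* Matrix (Fin N) (Fin N) ℂ) (S M : ℕ) [NeZero S] (U : GaugeConfig 4 S G) : ℝ :=
  ∑ p : Plaquette 4 S, if InnerP S M p then
    ((N : ℝ) - (ρ (plaquetteHolonomy U p.1 p.2.1.1 p.2.1.2)).trace.re) else 0

open Classical in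
/-- Far action: all the other plaquettes (outer ones and the wall-internal ones). `innerAction + farAction = wilsonAction`. -/
def farAction {N : ℕ} (ρ : G →* Matrix (Fin N) (Fin N) ℂ) (S M : ℕ) [NeZero S] (U : GaugeConfig 4 S G) : ℝ :=
  ∑ p : Plaquette 4 S, if InnerP S M p then 0 else
    ((N : ℝ) - (ρ (plaquetteHolonomy U p.1 p.2.1.1 p.2.1.2)).trace.re)

open Classical in
/-- Take `U` on the links where `P` holds and the frozen configuration `C` elsewhere. -/
def refit {S : ℕ} (P : Edge 4 S → Prop) (C U : GaugeConfig 4 S G) : GaugeConfig 4 S G :=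
  fun e => if P e then U e else C e

variable [TopologicalSpace G] [IsTopologicalGroup G] [CompactSpace G] [MeasurableSpace G] [BorelSpace G]

/-- Product Haar on all links of the torus. -/
def haarPi (S : ℕ) [NeZero S] : Measure (GaugeConfig 4 S G) := Measure.pi fun _ : Edge 4 S => haarProbability G

/-- **`Z_in(η)`** — the near-slab conditional partition function: inner links integrated against the inner Boltzmann
factor, everything else frozen at `η` (a function of the two walls of `η` only). -/
def nearZ {N : ℕ} (ρ : G →* Matrix (Fin N) (Fin N) ℂ) (β : ℝ) (S M : ℕ) [NeZero S] (η : GaugeConfig 4 S G) : ℝ :=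
  ∫ U, Real.exp (-β * innerAction ρ S M (refit (InnerE S M) η U)) ∂(haarPi S)

/-- **`K(η)` — THE FAR KERNEL**: outer links integrated against the far Boltzmann factor, walls frozen at `η`
(a function of the pair (positive wall, negative wall) of `η`; the wall-internal plaquettes contribute a product of
one-wall factors). -/
def farKernel {N : ℕ} (ρ : G →* Matrix (Fin N) (Fin N) ℂ) (β : ℝ) (S M : ℕ) [NeZero S] (η : GaugeConfig 4 S G) : ℝ :=
  ∫ U, Real.exp (-β * farAction ρ S M (refit (OuterE S M) η U)) ∂(haarPi S)

/-- Rank-one DEFECT numerator: `∫ Z_in(η) |K(η) − z(η) z(Θη)| dη`, `Θ = configPerm (0 1)` the swap (it exchanges the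
two walls), `z` a weight on the positive wall. -/
def defectNum {N : ℕ} (ρ : G →* Matrix (Fin N) (Fin N) ℂ) (β : ℝ) (S M : ℕ) [NeZero S]
    (z : GaugeConfig 4 S G → ℝ) : ℝ :=
  ∫ η, nearZ ρ β S M η * |farKernel ρ β S M η - z η * z (configPerm (Equiv.swap (0 : Fin 4) 1) η)| ∂(haarPi S)

/-- Rank-one mass (denominator): `∫ Z_in(η) z(η) z(Θη) dη`. -/
def defectDen {N : ℕ} (ρ : G →* Matrix (Fin N) (Fin N) ℂ) (β : ℝ) (S M : ℕ) [NeZero S]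
    (z : GaugeConfig 4 S G → ℝ) : ℝ :=
  ∫ η, nearZ ρ β S M η * (z η * z (configPerm (Equiv.swap (0 : Fin 4) 1) η)) ∂(haarPi S)

/-- Sanity (PROVED): at `β = 0` the far kernel is constant — rank one — and the defect against the constant wall weight VANISHES
(the structural reason the `β = 0` / one-element-`G` junk cases are exactly swap-RP, `Disproof.lean` §7–§10). -/
theorem defectNum_eq_zero_of_beta_zero {N : ℕ} (ρ : G →* Matrix (Fin N) (Fin N) ℂ) (S M : ℕ) [NeZero S] :
    defectNum ρ 0 S M (fun _ => Real.sqrt ((haarPi (G := G) S).real Set.univ)) = 0 := by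
  have hK : ∀ η : GaugeConfig 4 S G, farKernel ρ 0 S M η = (haarPi (G := G) S).real Set.univ := by
    intro η
    simp only [farKernel, neg_zero, zero_mul, Real.exp_zero, integral_const, smul_eq_mul, mul_one]
  have hz : Real.sqrt ((haarPi (G := G) S).real Set.univ) * Real.sqrt ((haarPi (G := G) S).real Set.univ) =
      (haarPi (G := G) S).real Set.univ :=
    Real.mul_self_sqrt MeasureTheory.measureReal_nonneg
  simp only [defectNum, hK, hz, sub_self, abs_zero, mul_zero, integral_zero]

/-- Admissible wall weights: measurable, bounded, reading only the positive wall. -/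
def IsWallWeight (S M : ℕ) (z : GaugeConfig 4 S G → ℝ) : Prop :=
  Measurable z ∧ (∃ Z₀ : ℝ, ∀ η, |z η| ≤ Z₀) ∧ DependsOn z {e : Edge 4 S | PosCollarE S M e}

end Model

/-! ## §C Statements: E1 (finite volume, provable), THE LETTER E2, the bridge E3 -/

section Statements

variable (G : Type) [Group G] [TopologicalSpace G] [IsTopologicalGroup G] [CompactSpace G]
  [MeasurableSpace G] [BorelSpace G]

/-- **E1 `MixtureBound` (fixed volume; the FIRST LEMMA of the line).**  On Wilson's torus of side `S ≥ 2M+5` at `β ≥ 0`,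
for every bounded measurable real `F` reading only the closed positive near half-slab `0 ≤ v ≤ M` and EVERY wall weight `z`
with defect `D_num(z) < D_den(z)`:  `∫ F(ΘU) F(U) dμ ≥ −‖F‖∞² · D_num(z) / (D_den(z) − D_num(z))`.
Proof plan: Fubini along the Markov cut `Z·⟨FΘ·F⟩ = ∫ dη K(η) Z_in^{FΘ·F}(η)`; FILS site-mirror factorisation INSIDE the slab
with frozen asymmetric collars (`LatticeRP.integral_mul_conj_mul_exp_nonneg_of_shared`, the `CubeHalfRP` mechanism) makes
`η ↦ Z_in^{FΘ·F}` a PSD kernel of (positive wall, Θ negative wall) dominated by `‖F‖∞² Z_in`; then §A `mixture_ratio_lower`.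
At a rank-one far kernel (`β = 0`; subsingleton `G`) the defect is `0`: EXACT swap-RP — the structural reason behind `Disproof.lean`
§7–§10. -/
def MixtureBound : Prop :=
  ∀ (N : ℕ) (ρ : G →* Matrix (Fin N) (Fin N) ℂ), Continuous ρ → (∀ g, ρ g ∈ Matrix.unitaryGroup (Fin N) ℂ) →
    ∀ (β : ℝ), 0 ≤ β → ∀ (S M : ℕ) [NeZero S], 2 ≤ M → 2 * M + 5 ≤ S →
      ∀ (F : GaugeConfig 4 S G → ℝ) (B : ℝ), Measurable F → (∀ U, |F U| ≤ B) →
        DependsOn F {e : Edge 4 S | PosNearE S M e} →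
          ∀ z : GaugeConfig 4 S G → ℝ, IsWallWeight S M z → defectNum ρ β S M z < defectDen ρ β S M z →
            -(B ^ 2 * defectNum ρ β S M z / (defectDen ρ β S M z - defectNum ρ β S M z)) ≤
              ∫ U, F (configPerm (Equiv.swap (0 : Fin 4) 1) U) * F U ∂(wilsonMeasure (d := 4) (L := S) ρ β)

/-- E1 as a stub of the line (crux-plan stage proves it; no sorry elsewhere in this file). -/
theorem stub_mixtureBound : MixtureBound G := by
  sorry

variable {G}
variable (r : LatticeRep G) (sch : SpeciesScheme (YMSpecies G))

/-- **E2 — THE LETTER `FarWallDecoupling`** (the far cylinder forgets one wall before it reaches the other).  Along the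
scheme there are slab half-widths `M_k` (`2 ≤ M_k`, `2M_k+5 ≤ side_k`, `a_k M_k → ∞`: every compact physical support fits
eventually) and wall weights `z_k` such that the normalised rank-one defect `D_k = D_num/D_den` of the far kernel of Wilson's OWN
torus at `β_k` decays faster than every power of the cutoff `a_k⁻¹` and of the physical volume `a_k side_k` — the currency in
which the renormalised observables grow (`famObs_supGrowth` under `Growth`).  Physically `log(K/z⊗zΘ)` is the wall–wall
interaction free energy `≈ (side_k)³ e^{−Δ a_k (side_k − 2M_k)}`; it is the two-parallel-walls instance of Dobrushin–Shlosman's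
cross-ratio (complete analyticity) condition and the `L¹` form of projective (Birkhoff) convergence of the diagonal transfer
KERNEL to rank one.  Why it might fail where the crux lives: for non-abelian `G` in `d = 4` at weak coupling no expansion
controlling free energies of the pure vacuum between two walls uniformly in the wall data is in print (IR-completeness, wall W-loc);
known: `β` small (Osterwalder–Seiler cluster expansion), finite `G` at large `β` (Adhikari–Cao swapping), `β = 0` / rank one exactly. -/
def FarWallDecoupling : Prop :=
  ∃ (M : ℕ → ℕ) (z : (k : ℕ) → GaugeConfig 4 (sch.side k) G → ℝ),
    (∀ᶠ k in atTop, 2 ≤ M k ∧ 2 * M k + 5 ≤ sch.side k) ∧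
    Tendsto (fun k => sch.a k * (M k : ℝ)) atTop atTop ∧
    (∀ᶠ k in atTop, IsWallWeight (sch.side k) (M k) (z k) ∧
      defectNum r.ρ (sch.β k) (sch.side k) (M k) (z k) < defectDen r.ρ (sch.β k) (sch.side k) (M k) (z k)) ∧
    ∀ p q : ℕ, Tendsto (fun k => (sch.a k)⁻¹ ^ p * (sch.a k * sch.side k) ^ q *
      (defectNum r.ρ (sch.β k) (sch.side k) (M k) (z k) / defectDen r.ρ (sch.β k) (sch.side k) (M k) (z k)))
      atTop (𝓝 0)

/-- **E3 — the bridge to the socket** (bookkeeping once E1 is in: `gramPairing = ∫ Y∘Θ · Y dμ`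
(`gramPairing_eq_integral_famObs_swap`), supports fit in `0 ≤ v ≤ M_k` eventually (pattern of `eventually_dependsOn_famObs`),
`‖Y_k‖∞ ≤ K a_k^{-P} (a_k side_k)^Q` (`famObs_supGrowth` under `Growth`), `β_k ≥ 0` eventually (weak coupling), E1 at every large
`k`, and `B_k² D_k/(1−D_k) → 0` by E2; `liminf ≥ 0` by `liminf_nonneg_of_eventually_ge`-type bookkeeping). -/
theorem stub_socket_of_farWallDecoupling (hE1 : MixtureBound G) (hw : sch.HasWeakCouplingLimit)
    (hgrowth : Growth r sch) (hfar : FarWallDecoupling r sch) : OddTorusSwapPairingLiminf r sch := by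
  sorry

end Statements

end Summit.QuantumFields.YangMills.Cruxes.WeakCouplingHypercubicLimitRP.FarKernelMixture

end
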